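import Summits.HodgeConjecture.CorCM.MumfordTateRankFour
import Literature.AlgebraicGeometry.ComplexMultiplication.CMTypeOfSimpleSubvariety
import Literature.AlgebraicGeometry.HodgeTheory.EllipticCurvesProductsHodgeClassesOfRiemann
import Literature.AlgebraicGeometry.ComplexMultiplication.FieldOfDegreeTwoDimIsotypic
import HarnessLib

/-!
# `dim MT(H¹(X)) = 4`, `X` not of CM type: the simple isogeny factor has dimension `1` or `2`; odd-dimensional `X`
# are powers of a non-CM elliptic curve and satisfy the Hodge conjecture

COR-CM (cell `pub-hodgecm2`, seat `b27` gen 30, count-neutral lane MT-RANK-FOUR, variety-level file 3; theorems only,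
no definition, no named fact; UNCONDITIONAL).  `CorCM/MumfordTateRankFour` shows: `X` complex abelian, `0 < dim X`, NOT
of CM type, `dim MT(H¹(X)) ≤ 4` ⟹ `X ∼ B^{m+1}` with `B` simple, `dim_ℚ End⁰(B) = (dim B)²`, `Z(End⁰ B) = ℚ`.  Here the
dimension of `B` is pinned WITHOUT Albert's classification:

* `finrank_endAlgebra_le_two_mul_dim_of_isSimple` — for every SIMPLE complex abelian variety `B` of positive dimension,
  `dim_ℚ End⁰(B) ≤ 2 dim B`: `End⁰(B)` is a division ring (Mumford §19 Cor. 2, the tree's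
  `endAlgebra_exists_inv_of_isSimple`) acting faithfully on `H¹(B(ℂ); ℚ)` (`bettiRep_injective`-style: `d ↦ d^* v` is
  injective for `v ≠ 0`), a space of dimension `2 dim B`.
* `dim_le_two_of_finrank_endAlgebra_eq_sq` — hence `dim_ℚ End⁰(B) = (dim B)²` forces `dim B ≤ 2`.
* **`exists_isIsogenous_power_dim_le_two_of_not_isOfCMType`** — `X ∼ B^{m+1}` with `B` simple non-CM of dimension `1`
  (`End⁰(B) = ℚ`) or `2` (`End⁰(B)` a NON-COMMUTATIVE central `ℚ`-algebra of dimension `4`, i.e. a quaternion algebra: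
  `not_comm_endAlgebra_of_dim_two`) — the classical list «powers of a non-CM elliptic curve or of a QM abelian
  surface» (Moonen–Zarhin 1999 §2, the abelian varieties with `Hg = SL₂`).
* **`exists_isIsogenous_powSucc_elliptic_of_odd_dim`**, **`hodgeConjectureFor_of_not_isOfCMType_of_odd_dim`** — if
  `dim X` is ODD then `dim B = 1`: `X ∼ E^{dim X}` for a non-CM elliptic curve `E`, `B(X) = D(X) ⊗ ℂ` and the Hodge
  conjecture holds for `X` (Tate / Imai, van Geemen Thm. 4.3: the tree's
  `isDivisorGenerated_of_isIsogenous_multiPowSucc_of_riemann` with Riemann's theorem `deligneMilne1982_Thm_6_20_full_holds`).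

## References

* [MoonenZarhin1999LowDim] B. Moonen, Yu. Zarhin, *Hodge classes on abelian varieties of low dimension*, Math. Ann.
  315 (1999), §2 (2.1)–(2.5), Cor. (3.9).
* [MumfordAV1970] D. Mumford, *Abelian Varieties* (1970), §19 Thm. 1 Cor. 1–2 and p. 174, Thm. 3 Cor. 1–2.
* [vanGeemen1994HodgeAV] B. van Geemen, *An introduction to the Hodge conjecture for abelian varieties*, LNM 1594
  (1994), Thm. 4.3.
* [LangeBirkenhake1992] H. Lange, Ch. Birkenhake, *Complex Abelian Varieties* (1992), §1.1 p. 10 (the rational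
  representation is faithful).
-/

noncomputable section

open CategoryTheory CategoryTheory.Limits Module

namespace Summit.HodgeConjecture.CorCM

open Literature.AlgebraicGeometry.Motives
open Literature.AlgebraicGeometry.Motives.AbelianVariety
open Literature.AlgebraicGeometry.Motives.HodgeStructure
open Literature.AlgebraicGeometry.HodgeTheory
open Literature.AlgebraicGeometry.ComplexMultiplication (bettiRep endAlgebra_exists_inv_of_isSimple
  isIsogenous_biproduct_powSucc)
open Literature.AlgebraicGeometry.Milne1999 (IsOfCMType)

/-! ## §1 `dim_ℚ End⁰(B) ≤ 2 dim B` for simple `B` -/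

section Simple

variable {B : AbelianVariety ℂ}

/-- **`dim_ℚ End⁰(B) ≤ 2 dim B` for every simple complex abelian variety `B` of positive dimension**: for `v ≠ 0` in
`H¹(B(ℂ); ℚ)` the `ℚ`-linear map `End⁰(B) → H¹`, `d ↦ d^* v`, is injective — if `d ≠ 0` then `d` is invertible in the
division ring `End⁰(B)` (Mumford §19 Cor. 2; `endAlgebra_exists_inv_of_isSimple`), `d d' = 1`, and
`v = (d')^* (d^* v)` — while `dim_ℚ H¹ = 2 dim B`. [cite: MumfordAV1970, §19 Cor. 2 of Thm. 1 (p. 174)]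
[cite: LangeBirkenhake1992, §1.1 p. 10] -/
theorem finrank_endAlgebra_le_two_mul_dim_of_isSimple (hB : B.IsSimple) (h0 : 0 < B.dim) :
    Module.finrank ℚ B.endAlgebra ≤ 2 * B.dim := by
  haveI : Module.Finite ℚ (bettiCohomology B.X 1) := finite_bettiCohomology_one B
  haveI := nontrivial_bettiCohomology_one h0
  obtain ⟨v, hv⟩ := exists_ne (0 : bettiCohomology B.X 1)
  -- `d ↦ d^* v`
  let ρ : B.endAlgebra →ₗ[ℚ] Module.End ℚ (bettiCohomology B.X 1) :=
    (MulOpposite.opLinearEquiv ℚ (M := Module.End ℚ (bettiCohomology B.X 1))).symm.toLinearMap ∘ₗ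
      (bettiRep B).toLinearMap
  let φ : B.endAlgebra →ₗ[ℚ] bettiCohomology B.X 1 := LinearMap.applyₗ v ∘ₗ ρ
  have hφ : ∀ d, φ d = MulOpposite.unop (bettiRep B d) v := fun d => rfl
  have hinj : Function.Injective φ := by
    rw [injective_iff_map_eq_zero]
    intro d hd
    by_contra hd0
    obtain ⟨d', hdd', -⟩ := endAlgebra_exists_inv_of_isSimple hB d hd0
    rw [hφ] at hd
    apply hv
    have h1 : MulOpposite.unop (bettiRep B (d * d')) = 1 := by rw [hdd', map_one, MulOpposite.unop_one]
    rw [map_mul, MulOpposite.unop_mul] at h1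
    have h := LinearMap.congr_fun h1 v
    rw [Module.End.mul_apply, hd, map_zero, Module.End.one_apply] at h
    exact h.symm
  have h := LinearMap.finrank_le_finrank_of_injective hinj
  rwa [finrank_bettiCohomology_one] at h

/-- **A simple complex abelian variety with `dim_ℚ End⁰(B) = (dim B)²` has `dim B ≤ 2`** (`(dim B)² ≤ 2 dim B`).
(Albert: `B` is an elliptic curve with `End⁰ = ℚ` or an abelian surface with quaternionic multiplication.)
[cite: MumfordAV1970, §19 Cor. 2 of Thm. 1 (p. 174)] [cite: MoonenZarhin1999LowDim, §2 (2.1)–(2.3)] -/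
theorem dim_le_two_of_finrank_endAlgebra_eq_sq (hB : B.IsSimple) (h0 : 0 < B.dim)
    (hsq : Module.finrank ℚ B.endAlgebra = B.dim ^ 2) : B.dim ≤ 2 := by
  have h := finrank_endAlgebra_le_two_mul_dim_of_isSimple hB h0
  rw [hsq, pow_two] at h
  exact Nat.le_of_mul_le_mul_right h h0

/-- **In dimension `2` the factor's `End⁰` is not commutative** (its centre `ℚ` has dimension `1 < 4 = dim End⁰(B)`),
i.e. `End⁰(B)` is a quaternion division algebra over `ℚ`. [cite: MoonenZarhin1999LowDim, §2 (2.3) (Type II)]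
[cite: MumfordAV1970, §19 (p. 174) and §21] -/
theorem not_comm_endAlgebra_of_finrank_center_lt {B : AbelianVariety ℂ}
    (hlt : Module.finrank ℚ (Subalgebra.center ℚ B.endAlgebra) < Module.finrank ℚ B.endAlgebra) :
    ¬ (∀ x y : B.endAlgebra, x * y = y * x) := by
  intro hcomm
  have htop : Subalgebra.center ℚ B.endAlgebra = ⊤ := by
    refine le_antisymm le_top fun x _ => ?_
    rw [Subalgebra.mem_center_iff]
    exact fun b => hcomm b x
  rw [htop, Subalgebra.topEquiv.toLinearEquiv.finrank_eq] at hlt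
  exact lt_irrefl _ hlt

end Simple

/-! ## §2 The simple factor of a non-CM `X` with `dim MT(H¹(X)) ≤ 4` has dimension `1` or `2` -/

section Factor

variable [HodgeTensorFacts.{0, 0}] {X : AbelianVariety ℂ} {n : ℕ}

/-- **Structure theorem, dimension of the factor.**  A complex abelian variety `X` with `0 < dim X`, NOT of CM type and
with `dim MT(H¹(X)) ≤ 4` is isogenous to `B^{m+1}` for ONE simple `B` not of CM type with `Z(End⁰ B) = ℚ`,
`dim_ℚ End⁰(B) = (dim B)²` and **`dim B = 1` (then `End⁰(B) = ℚ`) or `dim B = 2` (then `End⁰(B)` is a non-commutative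
central `ℚ`-algebra of dimension `4`)** — the abelian varieties with Hodge group `SL₂`: powers of a non-CM elliptic
curve or of a QM abelian surface. [cite: MoonenZarhin1999LowDim, §2 (2.1)–(2.3)] [cite: MumfordAV1970, §19 Thm. 1 Cor. 1–2] -/
theorem exists_isIsogenous_power_dim_le_two_of_not_isOfCMType (hX : IsSmoothProjective n X.X) (h0 : 0 < X.dim)
    (hcm : ¬ IsOfCMType X)
    (h4 : haveI := BettiUniverse.finite hX 1
      (BettiUniverse.hodge exists_isReal_hodgeModel_holds hX 1).mtRank ≤ 4) :
    ∃ (B : AbelianVariety ℂ) (m : ℕ), B.IsSimple ∧ ¬ IsOfCMType B ∧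
      IsIsogenous X (⨁ fun _ : Fin (m + 1) => B) ∧ X.dim = (m + 1) * B.dim ∧
      Module.finrank ℚ (Subalgebra.center ℚ B.endAlgebra) = 1 ∧
      ((B.dim = 1 ∧ Module.finrank ℚ B.endAlgebra = 1) ∨
        (B.dim = 2 ∧ Module.finrank ℚ B.endAlgebra = 4 ∧ ¬ ∀ x y : B.endAlgebra, x * y = y * x)) := by
  obtain ⟨B, m, hS, hB, hBcm, hXB, hdim, hsq, hZ⟩ := exists_isIsogenous_power_of_not_isOfCMType hX h0 hcm h4
  refine ⟨B, m, hS, hBcm, hXB, hdim, hZ, ?_⟩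
  have h2 := dim_le_two_of_finrank_endAlgebra_eq_sq hS hB hsq
  rcases Nat.lt_or_ge B.dim 2 with h | h
  · left
    have h1 : B.dim = 1 := by omega
    rw [h1] at hsq
    exact ⟨h1, by simpa using hsq⟩
  · right
    have h2' : B.dim = 2 := le_antisymm h2 h
    rw [h2'] at hsq
    refine ⟨h2', by simpa using hsq, not_comm_endAlgebra_of_finrank_center_lt ?_⟩
    rw [hZ, hsq]
    norm_num

/-- **Odd-dimensional non-CM `X` with `dim MT(H¹(X)) ≤ 4` is isogenous to a power of a non-CM elliptic curve**
(`dim X = (m+1) dim B` with `dim B ∈ {1, 2}`; `dim B = 2` would make `dim X` even).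
[cite: MoonenZarhin1999LowDim, §2 (2.1)] [cite: MumfordAV1970, §19 Thm. 1 Cor. 1] -/
theorem exists_isIsogenous_powSucc_elliptic_of_odd_dim (hX : IsSmoothProjective n X.X) (hodd : Odd X.dim)
    (hcm : ¬ IsOfCMType X)
    (h4 : haveI := BettiUniverse.finite hX 1
      (BettiUniverse.hodge exists_isReal_hodgeModel_holds hX 1).mtRank ≤ 4) :
    ∃ (E : AbelianVariety ℂ) (m : ℕ), E.dim = 1 ∧ ¬ IsOfCMType E ∧ Module.finrank ℚ E.endAlgebra = 1 ∧
      IsIsogenous X (E.powSucc m) ∧ X.dim = m + 1 := by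
  have h0 : 0 < X.dim := hodd.pos
  obtain ⟨B, m, -, hBcm, hXB, hdim, -, hcase⟩ := exists_isIsogenous_power_dim_le_two_of_not_isOfCMType hX h0 hcm h4
  rcases hcase with ⟨h1, hfin⟩ | ⟨h2, -, -⟩
  · refine ⟨B, m, h1, hBcm, hfin, hXB.trans (isIsogenous_biproduct_powSucc B m), ?_⟩
    rw [hdim, h1, mul_one]
  · exfalso
    rw [hdim, h2] at hodd
    exact (Nat.not_odd_iff_even.2 ⟨m + 1, by ring⟩) hodd

/-- **The Hodge conjecture for every ODD-dimensional complex abelian variety NOT of CM type with `dim MT(H¹(X)) ≤ 4`**: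
such an `X` is isogenous to a power of an elliptic curve, so `B(X) = D(X) ⊗ ℂ` (`IsDivisorGenerated X`) and the Hodge
conjecture holds for `X` (Tate / Imai; van Geemen Thm. 4.3 — `isDivisorGenerated_of_isIsogenous_multiPowSucc_of_riemann`
with Riemann's theorem `deligneMilne1982_Thm_6_20_full_holds`).  UNCONDITIONAL. [cite: vanGeemen1994HodgeAV, Thm. 4.3]
[cite: MoonenZarhin1999LowDim, Cor. (3.9)] -/
theorem hodgeConjectureFor_of_not_isOfCMType_of_odd_dim (hX : IsSmoothProjective n X.X) (hodd : Odd X.dim)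
    (hcm : ¬ IsOfCMType X)
    (h4 : haveI := BettiUniverse.finite hX 1
      (BettiUniverse.hodge exists_isReal_hodgeModel_holds hX 1).mtRank ≤ 4) :
    IsDivisorGenerated X ∧ HodgeConjectureFor X.dim X.X := by
  obtain ⟨E, m, hE1, -, -, hXE, -⟩ := exists_isIsogenous_powSucc_elliptic_of_odd_dim hX hodd hcm h4
  have hA : X.IsIsogenous (multiPowSucc 0 (fun _ => E) (fun _ => m)) := hXE
  exact ⟨isDivisorGenerated_of_isIsogenous_multiPowSucc_of_riemann deligneMilne1982_Thm_6_20_full_holds 0 _ _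
      (fun _ => hE1) hA,
    hodgeConjectureFor_of_isIsogenous_multiPowSucc_of_riemann deligneMilne1982_Thm_6_20_full_holds 0 _ _
      (fun _ => hE1) hA⟩

end Factor

end Summit.HodgeConjecture.CorCM

end
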